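import Literature.Analysis.FluidPDE.TaoAveragedRotationDisintegration
import Mathlib.MeasureTheory.Measure.Lebesgue.VolumeOfBalls
import Mathlib.Analysis.SpecialFunctions.Integrals.Basic
import HarnessLib

/-!
# Radial integrands on `ℝ³`: off-centre balls (Archimedes' hat-box), whole space, lens volume

Support file (all results proved, `ℝ≥0∞`-valued lower integrals, no integrability hypotheses)
for ball-averaging arguments in `ℝ³` (used by the discharge of Yuhjtman's bound on the
Lennard-Jones stability constant, `Yuhjtman2015Proofs.lean`):

* `setLIntegral_ball_radial` — for a ball `B(x, c)` NOT containing the origin (`0 < c < ‖x‖`) and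
  a radial integrand, `∫_{B(x,c)} f(‖y‖) dy = ∫_{‖x‖-c}^{‖x‖+c} (π/‖x‖) w (c² - (w - ‖x‖)²) f(w) dw`
  (the sphere of radius `w` meets `B(x,c)` in a cap of area `(π w/‖x‖)(c² - (w - ‖x‖)²)`,
  Archimedes' hat-box theorem); real-valued form `setLIntegral_ball_radial_ofReal`;
* `lintegral_radial_three` — `∫_{ℝ³} f(‖y‖) dy = ∫_0^∞ 4π w² f(w) dw`;
* `volume_ball_inter_ball_three` — the lens `B(x,c) ∩ B(0,c)` (`c < ‖x‖ ≤ 2c`) has volume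
  `(π/12)(2c - ‖x‖)²(‖x‖ + 4c)`.

All three are read off from the bipolar-coordinates disintegration already in the tree
(`Literature.Analysis.FluidPDE.Tao2016.lintegral_norm_norm_add`: the pair `(‖y‖, ‖y + z‖)` has
density `2π r₁ r₂/‖z‖` on the triangle-inequality region), applied with `z = -x`.

## References

* S. A. Yuhjtman, *A sensible estimate for the stability constant of the Lennard-Jones
  potential*, J. Stat. Phys. 160 (2015), Formulas 1 (a), (b) (cap area, lens volume). [Yuhjtman2015]
-/

noncomputable section

open Set Metric Real
open _root_.MeasureTheory _root_.MeasureTheory.Measure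
open scoped ENNReal

namespace Literature.MeasureTheory.Lebesgue

/-- `∫_{(a,b)} k r dr = k (b² - a²)/2` as a lower integral, for `k, a, b ≥ 0` (both sides vanish
when `b ≤ a`). [folklore] -/
theorem setLIntegral_Ioo_ofReal_const_mul {k a b : ℝ} (hk : 0 ≤ k) (ha : 0 ≤ a) (hb : 0 ≤ b) :
    ∫⁻ r in Ioo a b, ENNReal.ofReal (k * r) = ENNReal.ofReal (k * (b ^ 2 - a ^ 2) / 2) := by
  rcases le_or_gt b a with hba | hab
  · have h0 : k * (b ^ 2 - a ^ 2) / 2 ≤ 0 := by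
      have : b ^ 2 ≤ a ^ 2 := pow_le_pow_left₀ hb hba 2
      have : k * (b ^ 2 - a ^ 2) ≤ 0 := mul_nonpos_of_nonneg_of_nonpos hk (by linarith)
      linarith
    rw [Ioo_eq_empty (not_lt.2 hba), Measure.restrict_empty, lintegral_zero_measure,
      ENNReal.ofReal_of_nonpos h0]
  · have hint : IntegrableOn (fun r : ℝ => k * r) (Ioo a b) volume :=
      (Continuous.integrableOn_Icc (by fun_prop)).mono_set Ioo_subset_Icc_self
    have hnn : 0 ≤ᵐ[volume.restrict (Ioo a b)] fun r : ℝ => k * r := by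
      rw [Filter.EventuallyLE, ae_restrict_iff' measurableSet_Ioo]
      exact Filter.Eventually.of_forall fun r hr => mul_nonneg hk (ha.trans hr.1.le)
    rw [← ofReal_integral_eq_lintegral_ofReal hint hnn, ← integral_Ioc_eq_integral_Ioo,
      ← intervalIntegral.integral_of_le hab.le, intervalIntegral.integral_const_mul, integral_id]
    congr 1
    ring

/-- **Radial integrand over an off-centre ball (Archimedes' hat-box).** For `0 < c < ‖x‖` and a
measurable `f : ℝ → ℝ≥0∞`,
`∫_{B(x,c)} f(‖y‖) dy = ∫_{w ∈ (‖x‖-c, ‖x‖+c)} (π/‖x‖) · w · (c² - (w - ‖x‖)²) · f(w) dw`: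
the sphere `‖y‖ = w` meets the ball in a spherical cap of area `(π w/‖x‖)(c² - (w - ‖x‖)²)`
(Yuhjtman 2015, Formulas 1 (b)). [cite: Yuhjtman2015, Formulas 1 (b)] -/
theorem setLIntegral_ball_radial {x : EuclideanSpace ℝ (Fin 3)} {c : ℝ} (hc : 0 < c) (hcx : c < ‖x‖)
    (f : ℝ → ℝ≥0∞) (hf : Measurable f) :
    ∫⁻ y in ball x c, f ‖y‖ =
      ∫⁻ w in Ioo (‖x‖ - c) (‖x‖ + c),
        ENNReal.ofReal (π / ‖x‖ * w * (c ^ 2 - (w - ‖x‖) ^ 2)) * f w := by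
  set d : ℝ := ‖x‖ with hd
  have hd0 : 0 < d := hc.trans hcx
  have hx0 : x ≠ 0 := by
    intro h; rw [hd, h, norm_zero] at hd0; exact lt_irrefl _ hd0
  have hz : -x ≠ 0 := neg_ne_zero.2 hx0
  -- the integrand as a function of the two distances `‖y‖`, `‖y - x‖`
  set Φ : ℝ → ℝ → ℝ≥0∞ := fun r₁ r₂ => if r₂ < c then f r₁ else 0 with hΦ
  have hΦm : Measurable (Function.uncurry Φ) := by
    rw [hΦ]
    exact Measurable.ite (measurableSet_lt measurable_snd measurable_const) (hf.comp measurable_fst)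
      measurable_const
  have hstep1 : ∫⁻ y in ball x c, f ‖y‖ = ∫⁻ y : EuclideanSpace ℝ (Fin 3), Φ ‖y‖ ‖y + -x‖ := by
    rw [← lintegral_indicator measurableSet_ball]
    refine lintegral_congr fun y => ?_
    rw [hΦ]
    simp only [indicator, mem_ball, dist_eq_norm, ← sub_eq_add_neg]
  rw [hstep1, Literature.Analysis.FluidPDE.Tao2016.lintegral_norm_norm_add hz Φ hΦm, norm_neg, ← hd]
  -- the inner integral
  have hinner : ∀ r₁ ∈ Ioi (0 : ℝ),
      ∫⁻ r₂ in Ioo |d - r₁| (d + r₁), ENNReal.ofReal (r₁ * r₂) * Φ r₁ r₂ =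
        ENNReal.ofReal (r₁ * (c ^ 2 - (r₁ - d) ^ 2) / 2) * f r₁ := by
    intro r₁ hr₁
    rw [mem_Ioi] at hr₁
    have h1 : ∀ r₂, ENNReal.ofReal (r₁ * r₂) * Φ r₁ r₂ =
        (Iio c).indicator (fun r₂ => ENNReal.ofReal (r₁ * r₂) * f r₁) r₂ := by
      intro r₂
      rw [hΦ]
      by_cases h : r₂ < c
      · simp [h]
      · simp [h]
    have hm : Measurable fun r₂ : ℝ => ENNReal.ofReal (r₁ * r₂) := by fun_prop
    simp_rw [h1]
    rw [lintegral_indicator measurableSet_Iio, Measure.restrict_restrict measurableSet_Iio,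
      inter_comm, Ioo_inter_Iio, min_eq_right (by linarith : c ≤ d + r₁),
      lintegral_mul_const _ hm,
      setLIntegral_Ioo_ofReal_const_mul hr₁.le (abs_nonneg _) hc.le, sq_abs]
    congr 3
    ring
  rw [setLIntegral_congr_fun measurableSet_Ioi hinner,
    ← lintegral_const_mul' _ _ ENNReal.ofReal_ne_top]
  -- combine the constants and restrict to `(d - c, d + c)`
  have hcomb : ∀ r₁ ∈ Ioi (0 : ℝ),
      ENNReal.ofReal (2 * π / d) * (ENNReal.ofReal (r₁ * (c ^ 2 - (r₁ - d) ^ 2) / 2) * f r₁) =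
        (Ioo (d - c) (d + c)).indicator
          (fun w => ENNReal.ofReal (π / d * w * (c ^ 2 - (w - d) ^ 2)) * f w) r₁ := by
    intro r₁ hr₁
    rw [mem_Ioi] at hr₁
    by_cases hmem : r₁ ∈ Ioo (d - c) (d + c)
    · rw [indicator_of_mem hmem, ← mul_assoc, ← ENNReal.ofReal_mul (by positivity)]
      congr 2
      field_simp
    · rw [indicator_of_notMem hmem]
      have hle : c ^ 2 - (r₁ - d) ^ 2 ≤ 0 := by
        rw [mem_Ioo, not_and_or, not_lt, not_lt] at hmem
        have : c ^ 2 ≤ (r₁ - d) ^ 2 := by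
          rcases hmem with h | h
          · have h' : c ≤ d - r₁ := by linarith
            calc c ^ 2 ≤ (d - r₁) ^ 2 := pow_le_pow_left₀ hc.le h' 2
              _ = (r₁ - d) ^ 2 := by ring
          · exact pow_le_pow_left₀ hc.le (by linarith) 2
        linarith
      have h0 : r₁ * (c ^ 2 - (r₁ - d) ^ 2) / 2 ≤ 0 := by
        have := mul_nonpos_of_nonneg_of_nonpos hr₁.le hle
        linarith
      rw [ENNReal.ofReal_of_nonpos h0, zero_mul, mul_zero]
  rw [setLIntegral_congr_fun measurableSet_Ioi hcomb, lintegral_indicator measurableSet_Ioo,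
    Measure.restrict_restrict measurableSet_Ioo,
    inter_eq_left.2 (show Ioo (d - c) (d + c) ⊆ Ioi 0 from
      fun w hw => lt_trans (by linarith : (0 : ℝ) < d - c) hw.1)]

/-- Real-valued form of `setLIntegral_ball_radial`: for `0 < c < ‖x‖` and `g` measurable,
non-negative and integrable on `[‖x‖ - c, ‖x‖ + c]`,
`∫_{B(x,c)} g(‖y‖) dy = ∫_{‖x‖-c}^{‖x‖+c} (π/‖x‖) w (c² - (w - ‖x‖)²) g(w) dw`.
[cite: Yuhjtman2015, Formulas 1 (b)] -/
theorem setLIntegral_ball_radial_ofReal {x : EuclideanSpace ℝ (Fin 3)} {c : ℝ} (hc : 0 < c)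
    (hcx : c < ‖x‖)
    {g : ℝ → ℝ} (hgm : Measurable g) (hg0 : ∀ w ∈ Icc (‖x‖ - c) (‖x‖ + c), 0 ≤ g w)
    (hgi : IntegrableOn g (Icc (‖x‖ - c) (‖x‖ + c))) :
    ∫⁻ y in ball x c, ENNReal.ofReal (g ‖y‖) =
      ENNReal.ofReal (∫ w in (‖x‖ - c)..(‖x‖ + c), π / ‖x‖ * w * (c ^ 2 - (w - ‖x‖) ^ 2) * g w) := by
  set d : ℝ := ‖x‖ with hd
  have hd0 : 0 < d := hc.trans hcx
  rw [setLIntegral_ball_radial hc hcx _ hgm.ennreal_ofReal]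
  have hp : ∀ w ∈ Ioo (d - c) (d + c), 0 ≤ π / d * w * (c ^ 2 - (w - d) ^ 2) := by
    intro w hw
    have h1 : 0 < w := lt_trans (by linarith) hw.1
    have h2 : 0 ≤ c ^ 2 - (w - d) ^ 2 := by nlinarith [hw.1, hw.2]
    positivity
  have heq : ∀ w ∈ Ioo (d - c) (d + c),
      ENNReal.ofReal (π / d * w * (c ^ 2 - (w - d) ^ 2)) * ENNReal.ofReal (g w) =
        ENNReal.ofReal (π / d * w * (c ^ 2 - (w - d) ^ 2) * g w) := fun w hw => by
    rw [← ENNReal.ofReal_mul (hp w hw)]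
  rw [setLIntegral_congr_fun measurableSet_Ioo heq]
  have hcont : ContinuousOn (fun w : ℝ => π / d * w * (c ^ 2 - (w - d) ^ 2)) (Icc (d - c) (d + c)) :=
    (by fun_prop : Continuous fun w : ℝ => π / d * w * (c ^ 2 - (w - d) ^ 2)).continuousOn
  have hint : IntegrableOn (fun w => π / d * w * (c ^ 2 - (w - d) ^ 2) * g w) (Ioo (d - c) (d + c)) :=
    (hgi.continuousOn_mul hcont isCompact_Icc).mono_set Ioo_subset_Icc_self
  have hnn : 0 ≤ᵐ[volume.restrict (Ioo (d - c) (d + c))]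
      fun w => π / d * w * (c ^ 2 - (w - d) ^ 2) * g w := by
    rw [Filter.EventuallyLE, ae_restrict_iff' measurableSet_Ioo]
    exact Filter.Eventually.of_forall fun w hw =>
      mul_nonneg (hp w hw) (hg0 w (Ioo_subset_Icc_self hw))
  rw [← ofReal_integral_eq_lintegral_ofReal hint hnn, ← integral_Ioc_eq_integral_Ioo,
    ← intervalIntegral.integral_of_le (by linarith)]

/-- **Radial functions on `ℝ³`**: `∫_{ℝ³} f(‖y‖) dy = ∫_0^∞ 4π w² f(w) dw` (lower integrals).
[folklore] -/
theorem lintegral_radial_three (f : ℝ → ℝ≥0∞) (hf : Measurable f) :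
    ∫⁻ y : EuclideanSpace ℝ (Fin 3), f ‖y‖ =
      ∫⁻ w in Ioi (0 : ℝ), ENNReal.ofReal (4 * π * w ^ 2) * f w := by
  set z : EuclideanSpace ℝ (Fin 3) := EuclideanSpace.single 0 1 with hz_def
  have hz1 : ‖z‖ = 1 := by simp [hz_def]
  have hz : z ≠ 0 := by
    intro h; rw [h, norm_zero] at hz1; exact zero_ne_one hz1
  have hΦm : Measurable (Function.uncurry fun r₁ _ : ℝ => f r₁) := hf.comp measurable_fst
  have key := Literature.Analysis.FluidPDE.Tao2016.lintegral_norm_norm_add hz (fun r₁ _ => f r₁) hΦm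
  rw [hz1] at key
  simp only [div_one] at key
  rw [key]
  have hinner : ∀ r₁ ∈ Ioi (0 : ℝ),
      ∫⁻ r₂ in Ioo |1 - r₁| (1 + r₁), ENNReal.ofReal (r₁ * r₂) * f r₁ =
        ENNReal.ofReal (2 * r₁ ^ 2) * f r₁ := by
    intro r₁ hr₁
    rw [mem_Ioi] at hr₁
    have hm : Measurable fun r₂ : ℝ => ENNReal.ofReal (r₁ * r₂) := by fun_prop
    rw [lintegral_mul_const _ hm,
      setLIntegral_Ioo_ofReal_const_mul hr₁.le (abs_nonneg _) (by linarith), sq_abs]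
    congr 3
    ring
  rw [setLIntegral_congr_fun measurableSet_Ioi hinner, ← lintegral_const_mul' _ _ ENNReal.ofReal_ne_top]
  refine setLIntegral_congr_fun measurableSet_Ioi fun r₁ _ => ?_
  rw [← mul_assoc, ← ENNReal.ofReal_mul (by positivity)]
  congr 2
  ring

/-- **Volume of a lens** (intersection of two balls of equal radius `c` whose centres are at
distance `d = ‖x‖ ∈ (c, 2c]`): `vol(B(x,c) ∩ B(0,c)) = (π/12)(2c - d)²(d + 4c)`
(Yuhjtman 2015, Formulas 1 (a) with `r₁ = r₂ = c`). [cite: Yuhjtman2015, Formulas 1 (a)] -/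
theorem volume_ball_inter_ball_three {x : EuclideanSpace ℝ (Fin 3)} {c : ℝ} (hc : 0 < c)
    (hcx : c < ‖x‖) (hx2 : ‖x‖ ≤ 2 * c) :
    volume (ball x c ∩ ball (0 : EuclideanSpace ℝ (Fin 3)) c) =
      ENNReal.ofReal (π / 12 * (2 * c - ‖x‖) ^ 2 * (‖x‖ + 4 * c)) := by
  set d : ℝ := ‖x‖ with hd
  have hd0 : 0 < d := hc.trans hcx
  set g : ℝ → ℝ≥0∞ := fun w => if w < c then 1 else 0 with hg
  have hgm : Measurable g :=
    Measurable.ite (measurableSet_lt measurable_id measurable_const) measurable_const measurable_const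
  have h1 : volume (ball x c ∩ ball (0 : EuclideanSpace ℝ (Fin 3)) c) =
      ∫⁻ y in ball x c, g ‖y‖ := by
    rw [inter_comm, ← Measure.restrict_apply measurableSet_ball,
      ← lintegral_indicator_one measurableSet_ball]
    refine lintegral_congr fun y => ?_
    rw [hg]
    by_cases hy : ‖y‖ < c
    · simp [hy]
    · simp [hy]
  rw [h1, setLIntegral_ball_radial hc hcx g hgm, ← hd]
  have h2 : ∀ w, ENNReal.ofReal (π / d * w * (c ^ 2 - (w - d) ^ 2)) * g w =
      (Iio c).indicator (fun w => ENNReal.ofReal (π / d * w * (c ^ 2 - (w - d) ^ 2))) w := by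
    intro w
    rw [hg]
    by_cases hw : w < c
    · simp [hw]
    · simp [hw]
  simp_rw [h2]
  rw [lintegral_indicator measurableSet_Iio, Measure.restrict_restrict measurableSet_Iio, inter_comm,
    Ioo_inter_Iio, min_eq_right (by linarith : c ≤ d + c)]
  -- the remaining polynomial integral over `(d - c, c)`
  have hp : ∀ w ∈ Ioo (d - c) c, 0 ≤ π / d * w * (c ^ 2 - (w - d) ^ 2) := by
    intro w hw
    have h1 : 0 < w := lt_trans (by linarith) hw.1
    have h2 : 0 ≤ c ^ 2 - (w - d) ^ 2 := by nlinarith [hw.1, hw.2]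
    positivity
  have hint : IntegrableOn (fun w : ℝ => π / d * w * (c ^ 2 - (w - d) ^ 2)) (Ioo (d - c) c) :=
    (Continuous.integrableOn_Icc (by fun_prop)).mono_set Ioo_subset_Icc_self
  have hnn : 0 ≤ᵐ[volume.restrict (Ioo (d - c) c)] fun w : ℝ => π / d * w * (c ^ 2 - (w - d) ^ 2) := by
    rw [Filter.EventuallyLE, ae_restrict_iff' measurableSet_Ioo]
    exact Filter.Eventually.of_forall hp
  rw [← ofReal_integral_eq_lintegral_ofReal hint hnn, ← integral_Ioc_eq_integral_Ioo,
    ← intervalIntegral.integral_of_le (by linarith)]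
  congr 1
  -- the polynomial integral
  have e : ∀ w, π / d * w * (c ^ 2 - (w - d) ^ 2) =
      π / d * ((c ^ 2 - d ^ 2) * w + 2 * d * w ^ 2 - w ^ 3) := fun w => by ring
  simp_rw [e]
  rw [intervalIntegral.integral_const_mul, intervalIntegral.integral_sub,
    intervalIntegral.integral_add, intervalIntegral.integral_const_mul,
    intervalIntegral.integral_const_mul, integral_id, integral_pow, integral_pow]
  · field_simp
    ring
  all_goals
    apply Continuous.intervalIntegrable
    fun_prop

end Literature.MeasureTheory.Lebesgue

end
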